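import Summits.QuantumFields.YangMills.Theorems.FluctuationComparisonRegPrIntLS2BetaComposedDilutionKernel
import HarnessLib

/-!
# S2β · (S-SRC-4) THE ENERGY STEP OF THE LOWER-LEFT ROWS: `Σ_{y′} ρ_{i+1}(y′)² ≤ 2·L²·m_P·Σ_z ρ_i(z)² + 2·‖src_{i+1}‖₂²` (`L²·m_P = L^{4−d}`: energies grow by `L` per level at
# `d = 3`), and the CORNER MULTIPLICITY `Σ_{y′} Σ_{b ∈ corners(y′)} g b ≤ 4·Σ_b g b` — the two counting inputs of the (S-SRC) source budget's energy chain (ARCHITECT RULING 19:27:44Z)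

Cell `ym3-torus` (YM ladder rung R3 = continuum `SU(2)` Yang–Mills on the three-torus at fixed lattice data — a RUNG: NOT d = 4, NOT infinite volume, NOT a mass gap,
NOT Clay).  Width seat `ym3-torus-px13` (gen 27); crux `stmt-QuantumFields-20520`, LINE g18-1 S2β, pairing lane; (SCT″-c)₁ source budget (S-SRC), px13 g27 holder.  The quadratic chart
remainder `q·M²` of ✓p831575's rows is priced by (RSP) × ENERGY: `Σ_z M⁴ ≤ s²·Σ_z M²`, and the chord∕curl ENERGIES propagate through the one-step average with the Schur constant
`rowsum × colsum = L²·m_P` (Cauchy–Schwarz over the `|I|·L²` summands, then px16 g23's joint count ✓`sum_sum_baseLL_le`).  `--kind proof --supports stmt-QuantumFields-20520 --as helper`,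
count-neutral, DEFINITION-FREE; generic `P : Params`, standing range; `m_P := (d!)²L²∕|I|`.

WHAT IS PROVED (sorry-free).  ★`sq_le_two_sq_add_two_sq_of_le` (`0 ≤ a ≤ b + c ⟹ a² ≤ 2b² + 2c²`); ★★`sum_sq_avg_baseLL_le` — `Σ_{y′∈T^{(j+1)}} (|I|⁻¹Σ_a f(x_a(y′)))² ≤ L²·m_P·Σ_z f z²`;
★★★`energy_row_le` — for `ρ ≥ 0` obeying the lower-left rows with sources: `Σ_{y′} ρ (i+1) y′² ≤ 2·(L²·m_P)·Σ_z ρ i z² + 2·Σ_{y′} src (i+1) y′²`; ★`card_corner_bases_le` (a block is a corner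
of at most four plaquette bases `y′`) and ★★`sum_corner_le` — `Σ_{y′} Σ_{b : corner(b, y′)} g b ≤ 4·Σ_b g b` for `g ≥ 0` on fine bonds.

HONEST.  Finite-sum algebra; nothing of Bałaban's asserted; (RSP), (BKG), the chord-energy ← curl-energy gauge letter, the dock's use, (SCT″-c)₁₂₃, (ST″), LOC, GAP♯∘ (`stub_uniformFibreGapOrbit`,
registry 3732b7df UNTOUCHED, 0∕5), the five REGISTERED stubs, S2β, crux 20520, 19936, 19200, `YM3TorusSU2` — NOT proved; rung R3 = SU(2) YM₃ on T³ — NOT d = 4, NOT infinite volume,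
NOT a mass gap, NOT Clay; the Yang–Mills mass gap is NOT proved.  Axioms standard.

References: [Balaban1985Averaging] CMP **98** (1985) (19)–(20) p.21, Prop. 1 (51) p.26; [Balaban1987RG1] CMP **109** (1987) (0.1)–(0.4) pp.251–253.
-/

set_option autoImplicit false

noncomputable section

namespace Summit.QuantumFields.YangMills.Theorems.FluctuationComparisonRegPrIntLS2BetaSourceEnergy

open scoped BigOperators
open Finset
open Literature.MathematicalPhysics.QuantumFieldTheory.Balaban1983to89
open Literature.MathematicalPhysics.QuantumFieldTheory.Balaban1983to89.T4Continuum
open Literature.MathematicalPhysics.QuantumFieldTheory.Balaban1983to89.BlockAveraging (Idx)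
open Literature.MathematicalPhysics.QuantumFieldTheory.Balaban1983to89.B10Eq47AxialChi (shiftN shiftN_succ shiftN_zero)
open Literature.MathematicalPhysics.QuantumFieldTheory.Balaban1983to89.B10StarCount (shift_unshift unshift_shift)
open Summit.QuantumFields.YangMills.Theorems.FluctuationComparisonRegPrIntLS2BetaComposedDilutionKernel (card_triples sum_sum_baseLL_le)

variable {P : Params}

/-! ## §1 The Schur step for the one-step lower-left average -/

section Schur

/-- ★ `0 ≤ a ≤ b + c ⟹ a² ≤ 2b² + 2c²`. [folklore] -/
theorem sq_le_two_sq_add_two_sq_of_le {a b c : ℝ} (ha : 0 ≤ a) (h : a ≤ b + c) : a ^ 2 ≤ 2 * b ^ 2 + 2 * c ^ 2 := by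
  have h1 : a ^ 2 ≤ (b + c) ^ 2 := pow_le_pow_left₀ ha h 2
  nlinarith [sq_nonneg (b - c)]

/-- ★★ **THE ENERGY OF THE ONE-STEP AVERAGE**: `Σ_{y′} (|I|⁻¹·Σ_a f(x_a(y′)))² ≤ L²·m_P·Σ_z f z²` (Cauchy–Schwarz over the `|I|·L²` summands, then the joint count ✓`sum_sum_baseLL_le`:
every fine site is a base point of at most `(d!)²L²` summands over all coarse plaquettes together). [cite: Balaban1985Averaging, (19)-(20) p.21, Prop. 1 (51) p.26] -/
theorem sum_sq_avg_baseLL_le {j : ℕ} (hj : j + 1 ≤ P.m + P.K) (μ ν : Fin P.d) (f : Site P j → ℝ) :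
    ∑ y : Site P (j + 1), ((Fintype.card (Idx P) : ℝ)⁻¹ *
        ∑ a ∈ (Finset.univ : Finset (Idx P)) ×ˢ (Finset.range P.L ×ˢ Finset.range P.L), f (shiftN (shiftN (Site.blockSite y a.1.1) μ a.2.1) ν a.2.2)) ^ 2 ≤
      ((P.L : ℝ) ^ 2 * (((((Fintype.card (Equiv.Perm (Fin P.d))) ^ 2 * P.L ^ 2 : ℕ) : ℝ)) / (Fintype.card (Idx P) : ℝ))) * ∑ z, f z ^ 2 := by
  classical
  set A : Finset (Idx P × (ℕ × ℕ)) := (Finset.univ : Finset (Idx P)) ×ˢ (Finset.range P.L ×ˢ Finset.range P.L) with hA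
  set cI : ℝ := (Fintype.card (Idx P) : ℝ) with hcI
  set C : ℝ := ((((Fintype.card (Equiv.Perm (Fin P.d))) ^ 2 * P.L ^ 2 : ℕ) : ℝ)) with hC
  have hcIpos : 0 < cI := by rw [hcI]; exact_mod_cast Fintype.card_pos
  have hcardA : (A.card : ℝ) = cI * (P.L : ℝ) ^ 2 := by rw [hA, card_triples, hcI]; push_cast; ring
  -- Cauchy–Schwarz per coarse plaquette
  have hcs : ∀ y : Site P (j + 1), (cI⁻¹ * ∑ a ∈ A, f (shiftN (shiftN (Site.blockSite y a.1.1) μ a.2.1) ν a.2.2)) ^ 2 ≤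
      cI⁻¹ * (P.L : ℝ) ^ 2 * ∑ a ∈ A, f (shiftN (shiftN (Site.blockSite y a.1.1) μ a.2.1) ν a.2.2) ^ 2 := by
    intro y
    have h := sq_sum_le_card_mul_sum_sq (s := A) (f := fun a => f (shiftN (shiftN (Site.blockSite y a.1.1) μ a.2.1) ν a.2.2))
    rw [hcardA] at h
    have hinv : 0 ≤ cI⁻¹ := inv_nonneg.mpr hcIpos.le
    calc (cI⁻¹ * ∑ a ∈ A, f (shiftN (shiftN (Site.blockSite y a.1.1) μ a.2.1) ν a.2.2)) ^ 2
        = cI⁻¹ ^ 2 * (∑ a ∈ A, f (shiftN (shiftN (Site.blockSite y a.1.1) μ a.2.1) ν a.2.2)) ^ 2 := by ring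
      _ ≤ cI⁻¹ ^ 2 * (cI * (P.L : ℝ) ^ 2 * ∑ a ∈ A, f (shiftN (shiftN (Site.blockSite y a.1.1) μ a.2.1) ν a.2.2) ^ 2) :=
          mul_le_mul_of_nonneg_left h (sq_nonneg _)
      _ = cI⁻¹ * (P.L : ℝ) ^ 2 * ∑ a ∈ A, f (shiftN (shiftN (Site.blockSite y a.1.1) μ a.2.1) ν a.2.2) ^ 2 := by
          field_simp
  -- the joint count for `f²`
  have hjoint := sum_sum_baseLL_le hj μ ν (fun z => f z ^ 2) (fun z => sq_nonneg _)
  calc ∑ y : Site P (j + 1), (cI⁻¹ * ∑ a ∈ A, f (shiftN (shiftN (Site.blockSite y a.1.1) μ a.2.1) ν a.2.2)) ^ 2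
      ≤ ∑ y : Site P (j + 1), cI⁻¹ * (P.L : ℝ) ^ 2 * ∑ a ∈ A, f (shiftN (shiftN (Site.blockSite y a.1.1) μ a.2.1) ν a.2.2) ^ 2 := sum_le_sum fun y _ => hcs y
    _ = cI⁻¹ * (P.L : ℝ) ^ 2 * ∑ y : Site P (j + 1), ∑ a ∈ A, f (shiftN (shiftN (Site.blockSite y a.1.1) μ a.2.1) ν a.2.2) ^ 2 := by rw [← mul_sum]
    _ ≤ cI⁻¹ * (P.L : ℝ) ^ 2 * (C * ∑ z, f z ^ 2) :=
        mul_le_mul_of_nonneg_left hjoint (mul_nonneg (inv_nonneg.mpr hcIpos.le) (sq_nonneg _))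
    _ = ((P.L : ℝ) ^ 2 * (C / cI)) * ∑ z, f z ^ 2 := by rw [div_eq_mul_inv]; ring

/-- ★★★ **THE ENERGY ROW**: for `ρ ≥ 0` obeying the lower-left rows with sources at the step `i → i+1`,
`Σ_{y′} ρ (i+1) y′² ≤ 2·(L²·m_P)·Σ_z ρ i z² + 2·Σ_{y′} src (i+1) y′²` — energies grow by at most `2·L^{4−d}` per level plus twice the source energy. [cite: Balaban1985Averaging, Prop. 1 (51) p.26] -/
theorem energy_row_le {i : ℕ} (hi : i + 1 ≤ P.m + P.K) (μ ν : Fin P.d) (ρi : Site P i → ℝ) (ρs src : Site P (i + 1) → ℝ)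
    (hρs : ∀ y, 0 ≤ ρs y)
    (hrow : ∀ y : Site P (i + 1), ρs y ≤ (Fintype.card (Idx P) : ℝ)⁻¹ *
        ∑ a ∈ (Finset.univ : Finset (Idx P)) ×ˢ (Finset.range P.L ×ˢ Finset.range P.L), ρi (shiftN (shiftN (Site.blockSite y a.1.1) μ a.2.1) ν a.2.2) + src y) :
    ∑ y, ρs y ^ 2 ≤ 2 * ((P.L : ℝ) ^ 2 * (((((Fintype.card (Equiv.Perm (Fin P.d))) ^ 2 * P.L ^ 2 : ℕ) : ℝ)) / (Fintype.card (Idx P) : ℝ))) * ∑ z, ρi z ^ 2 +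
      2 * ∑ y, src y ^ 2 := by
  have hpt : ∀ y : Site P (i + 1), ρs y ^ 2 ≤ 2 * ((Fintype.card (Idx P) : ℝ)⁻¹ *
        ∑ a ∈ (Finset.univ : Finset (Idx P)) ×ˢ (Finset.range P.L ×ˢ Finset.range P.L), ρi (shiftN (shiftN (Site.blockSite y a.1.1) μ a.2.1) ν a.2.2)) ^ 2 + 2 * src y ^ 2 :=
    fun y => sq_le_two_sq_add_two_sq_of_le (hρs y) (hrow y)
  have havg := sum_sq_avg_baseLL_le hi μ ν ρi
  calc ∑ y, ρs y ^ 2 ≤ ∑ y : Site P (i + 1), (2 * ((Fintype.card (Idx P) : ℝ)⁻¹ *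
        ∑ a ∈ (Finset.univ : Finset (Idx P)) ×ˢ (Finset.range P.L ×ˢ Finset.range P.L), ρi (shiftN (shiftN (Site.blockSite y a.1.1) μ a.2.1) ν a.2.2)) ^ 2 + 2 * src y ^ 2) :=
        sum_le_sum fun y _ => hpt y
    _ = 2 * ∑ y : Site P (i + 1), ((Fintype.card (Idx P) : ℝ)⁻¹ *
        ∑ a ∈ (Finset.univ : Finset (Idx P)) ×ˢ (Finset.range P.L ×ˢ Finset.range P.L), ρi (shiftN (shiftN (Site.blockSite y a.1.1) μ a.2.1) ν a.2.2)) ^ 2 + 2 * ∑ y, src y ^ 2 := by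
        rw [sum_add_distrib, ← mul_sum, ← mul_sum]
    _ ≤ _ := by linarith [havg]

end Schur

/-! ## §2 The corner multiplicity -/

section Corner

/-- ★ **A BLOCK IS A CORNER OF AT MOST FOUR PLAQUETTE BASES**: `#{y′ : c ∈ {y′, y′+e_μ, y′+e_ν, y′+e_μ+e_ν}} ≤ 4`. [folklore] -/
theorem card_corner_bases_le {k : ℕ} (c : Site P k) (μ ν : Fin P.d) :
    (univ.filter (fun y' : Site P k => c = y' ∨ c = y'.shift μ ∨ c = y'.shift ν ∨ c = (y'.shift μ).shift ν)).card ≤ 4 := by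
  classical
  have hsub : univ.filter (fun y' : Site P k => c = y' ∨ c = y'.shift μ ∨ c = y'.shift ν ∨ c = (y'.shift μ).shift ν) ⊆
      {c, c.unshift μ, c.unshift ν, (c.unshift ν).unshift μ} := by
    intro y' hy'
    rw [mem_filter] at hy'
    simp only [mem_insert, mem_singleton]
    rcases hy'.2 with h | h | h | h
    · exact Or.inl h.symm
    · exact Or.inr (Or.inl (by rw [h, unshift_shift]))
    · exact Or.inr (Or.inr (Or.inl (by rw [h, unshift_shift])))
    · exact Or.inr (Or.inr (Or.inr (by rw [h, unshift_shift, unshift_shift])))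
  refine (card_le_card hsub).trans ?_
  refine (card_insert_le _ _).trans ?_
  refine (Nat.succ_le_succ (card_insert_le _ _)).trans ?_
  refine (Nat.succ_le_succ (Nat.succ_le_succ (card_insert_le _ _))).trans ?_
  rw [card_singleton]

/-- ★★ **THE CORNER MULTIPLICITY**: summing a nonnegative bond function over the corner bonds of every coarse plaquette base counts each bond at most four times:
`Σ_{y′} Σ_{b : blockOf b.src ∈ corners(y′)} g b ≤ 4·Σ_b g b`. [cite: Balaban1987RG1, (0.1)-(0.3) p.252 (bookkeeping)] -/
theorem sum_corner_le {j : ℕ} (μ ν : Fin P.d) (g : PBond P j → ℝ) (hg : ∀ b, 0 ≤ g b) :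
    ∑ y' : Site P (j + 1), ∑ b ∈ univ.filter (fun b : PBond P j =>
        blockOf b.src = y' ∨ blockOf b.src = y'.shift μ ∨ blockOf b.src = y'.shift ν ∨ blockOf b.src = (y'.shift μ).shift ν), g b ≤ 4 * ∑ b, g b := by
  classical
  -- swap the sums: each bond is counted once per base `y′` of which its block is a corner
  have hswap : ∑ y' : Site P (j + 1), ∑ b ∈ univ.filter (fun b : PBond P j =>
        blockOf b.src = y' ∨ blockOf b.src = y'.shift μ ∨ blockOf b.src = y'.shift ν ∨ blockOf b.src = (y'.shift μ).shift ν), g b =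
      ∑ b : PBond P j, ((univ.filter (fun y' : Site P (j + 1) =>
        blockOf b.src = y' ∨ blockOf b.src = y'.shift μ ∨ blockOf b.src = y'.shift ν ∨ blockOf b.src = (y'.shift μ).shift ν)).card : ℝ) * g b := by
    rw [sum_comm' (t' := univ) (s' := fun b => univ.filter (fun y' : Site P (j + 1) =>
        blockOf b.src = y' ∨ blockOf b.src = y'.shift μ ∨ blockOf b.src = y'.shift ν ∨ blockOf b.src = (y'.shift μ).shift ν))]
    · refine sum_congr rfl fun b _ => ?_
      rw [sum_const, nsmul_eq_mul]
    · intro y' b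
      simp only [mem_filter, mem_univ, true_and, and_true]
  rw [hswap, mul_sum]
  refine sum_le_sum fun b _ => mul_le_mul_of_nonneg_right ?_ (hg b)
  exact_mod_cast card_corner_bases_le (blockOf b.src) μ ν

end Corner

end Summit.QuantumFields.YangMills.Theorems.FluctuationComparisonRegPrIntLS2BetaSourceEnergy

end
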